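import Literature.NumberTheory.LFunctions.SuzukiScrewLineL2Proofs
import Literature.NumberTheory.LFunctions.SuzukiWeilHilbertSpace
import Literature.NumberTheory.LFunctions.WeilGroundEnergyParitySplit
import Literature.NumberTheory.LFunctions.WeilSmallSupportPositivity
import Literature.NumberTheory.LFunctions.ZetaScrewThm41Proofs
import HarnessLib

/-!
# The even extension `𝔖_{−t} := 𝔖_t` of Suzuki's screw line: what the typed statements say (kernel negatives)

LINE 1 — LABEL: RH-FREE NEGATIVE KNOWLEDGE about TYPED statements of the cell rh-crit/dbl (faithfulness
audit of `SuzukiScrewLine.lean` / `SuzukiWeilHilbertSpace.lean` against M. Suzuki, *On the Hilbert space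
derived from the Weil distribution*, Canad. J. Math. 2025 = arXiv:2301.00421v3). bears_on: B-C/B-P
(LADDER-RH COLUMN 6 DBR) — Literature hygiene only. WHAT THIS IS NOT: nothing here bears on the truth of
RH; no statement about the zeros of `ζ` is proved or refuted. What is shown is that five typed `def … : Prop`
records, which transcribe VERBATIM the printed convention "For negative `t`, we set `𝔖_t(z) := 𝔖_{−t}(z)`"
(CJM p. 2, TeX l.359; also `P_t := P_{−t}`, TeX l.780), are — exactly as typed — not the theorems the
paper proves: one is false outright and four are equivalent to `¬ RiemannHypothesis`. The defect is IN
PRINT: the even extension (TeX l.359, l.780) contradicts the paper's own (3.7)–(3.8) (which integrate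
`(e^{iγt} − 1)φ(t)` over ALL real `t` to get `φ̂(γ) − φ̂(0)`) and (4.4) at `t, u` of opposite signs
(with (4.9), `G_g(t,−t) = g(2t) − 2g(t) ≠ G_g(t,t)`); the typing is faithful to the letter. A repaired
typing (the zero-expansion convention `P_t(z) = Σ m_γ (e^{−iγt}−1)/(γ(z−γ))` for ALL real `t`, which by
the symmetry `γ ↦ −γ` of `Γ` reads `P_t(z) = P_{|t|}(−z)`, `𝔓_t(z) := 𝔓_{|t|}(−z)` for `t < 0`) is the
cell lead's call and is NOT introduced here (no definition, no named fact in this file).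

## The mechanism (all RH-FREE, elementary)

* `𝔓_t`, `𝔖_t` (`screwP`, `screwLine`) depend on `t` only through `|t|` (`screwP_neg`, `screwLine_neg`).
* Hence `P̂_φ(z) = ∫ 𝔖_t♯(z) φ(t) dt` (`screwPhat`) VANISHES IDENTICALLY for every odd `φ`
  (`screwPhat_eq_zero_of_odd`), and `Dψ = iψ′` is odd for even `ψ` (`suzukiD_neg_of_even`), so
  `P̂_{Dψ} ≡ 0` and `‖ψ‖₀ = 0` for every EVEN test function `ψ` (`screwNormZero_eq_zero_of_even`).
* Even test functions `ψ ≠ 0` with small support exist and have `Re ⟨ψ,ψ⟩_W ≥ ‖ψ‖₂² > 0`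
  UNCONDITIONALLY (Bombieri 2000, Thm. 12 = the tree's `weilQuadratic_coercive`; even unit vectors:
  `exists_isWeilTest_even_sphere`).

## Consequences for the typed records

* `Suzuki2025_lemma32_false : ¬ Suzuki2025_lemma32` — clause (iii) "‖ψ‖₀ = 0 ⇒ ψ = 0" fails at every
  even `ψ ≠ 0` (CJM Lemma 3.2, TeX l.1073–1093, is false under the printed convention l.359).
* `Suzuki2025_thm42_iff_not_riemannHypothesis` — clause (4.4) "for `t, u ∈ ℝ`" at `(t,t)` and `(t,−t)`
  forces `Ψ(2t) = 0`, contradicting `Ψ > 0` on `(0, log 2]` (`Suzuki2023Thm41.zetaScrew_pos_of_le_log_two`); so the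
  typed RH-CONSEQUENCE `RiemannHypothesis → …` is equivalent to `¬ RiemannHypothesis`.
* `Suzuki2025_thm14_iff_not_riemannHypothesis`, `Suzuki2025_thm44_iff_not_riemannHypothesis`,
  `Suzuki2025_cor15_iff_not_riemannHypothesis` — the right-hand sides of the typed criteria (1.9), (4.7)/(4.8),
  (1.10) are FALSE unconditionally (test them on an even `ψ`, resp. the odd `φ = Dψ`, resp. the element
  `0 = 𝖥⁻¹P̂_{Dψ} ∈ V°(0)` generated by an even `ψ`), so each typed `RiemannHypothesis ↔ …` record is
  equivalent to `¬ RiemannHypothesis`.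
Users: every tree theorem taking `(h : Suzuki2025_thm42)` / `(h : Suzuki2025_thm44)` /
`(h : Suzuki2025_thm14)` / `(h : Suzuki2025_cor15)` as a hypothesis is (as of this file) a theorem
under `¬RH`; the RH-free doors `Suzuki2025_thm14_if`, `Suzuki2025_thm44_mpr`, `Suzuki2025_cor15_if'`
remain correct but their hypotheses are UNSATISFIABLE as typed (vacuous); `Suzuki2025_cor43(_mpr)`,
`Suzuki2025_thm71`, `Suzuki2025_prop12/13/31` involve only `t ≥ 0` (or are even-symmetric on both
sides) and `Suzuki2025_prop41` carries no `t`: NOT affected. Also built on the even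
`𝔖_t`: the sets `screwK0` (`𝓚₀`) and `suzukiVcirc` (`V°(0)`), hence `Suzuki2025_thm56_closure` — as typed
they only see the odd parts `ψ(t) − ψ(−t)` of test functions; no claim about them is made here.

## References
* M. Suzuki, Canad. J. Math. 2025 = arXiv:2301.00421v3: p. 2 (TeX l.359) "For negative t, we set
  𝔖_t(z) := 𝔖_{−t}(z)"; Lemma 3.2 (l.1073–1093); Thm. 4.2 (l.1182–1194); Thm. 4.4 (l.1274–1284);
  Thm. 1.4 (l.420–430); Cor. 1.5 (l.438–451); (3.6)–(3.8) (l.1026–1056). [Suzuki2025WeilHilbertSpace]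
* E. Bombieri, *Remarks on Weil's quadratic functional…* (2000), Thm. 12 (small-support positivity,
  tree `weilQuadratic_coercive`). [Bombieri2000]
* M. Suzuki, J. London Math. Soc. 2023, Thm. 4.1 (`Ψ > 0` on `(0, log 2]`, tree
  `zetaScrew_pos_of_le_log_two`). [Suzuki2023]
-/

noncomputable section

open MeasureTheory Complex Filter Set Real
open Literature.Analysis.DeBrangesSpaces (sharp)
open scoped ComplexConjugate Topology

namespace Literature.NumberTheory.LFunctions

namespace ScrewLineEvenExtension

/-! ## A. Evenness in `t` of the typed objects -/

/-- The Hurwitz–Lerch bracket of (1.6) is even in `t` (it is typed through `|t|`).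
[cite: Suzuki2025WeilHilbertSpace, eq. (1.6) (TeX l.325–345) with l.359] -/
theorem screwLerchBracket_neg (t : ℝ) (z : ℂ) : screwLerchBracket (-t) z = screwLerchBracket t z := by
  simp only [screwLerchBracket, abs_neg]

/-- `𝔓_{−t} = 𝔓_t` as typed (every occurrence of `t` in (1.6) is `|t|`).
[cite: Suzuki2025WeilHilbertSpace, TeX l.359 ("For negative t, we set 𝔖_t(z) := 𝔖_{−t}(z)")] -/
theorem screwP_neg (t : ℝ) : screwP (-t) = screwP t := by
  funext z
  simp only [screwP, screwLerchBracket_neg, abs_neg]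

/-- `𝔖_{−t} = 𝔖_t` as typed — the printed convention. [cite: Suzuki2025WeilHilbertSpace, TeX l.359] -/
theorem screwLine_neg (t : ℝ) : screwLine (-t) = screwLine t := by
  funext z
  simp only [screwLine, screwP_neg]

/-- **`P̂_φ ≡ 0` for every odd `φ`**: the integrand `𝔖_t♯(z)φ(t)` of (1.7) is odd in `t`.
RH-FREE. [cite: Suzuki2025WeilHilbertSpace, eq. (1.7) (TeX l.395–405) with l.359] -/
theorem screwPhat_eq_zero_of_odd {φ : ℝ → ℂ} (hφ : ∀ t, φ (-t) = -φ t) (z : ℂ) :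
    screwPhat φ z = 0 := by
  unfold screwPhat
  have h : ∫ t : ℝ, sharp (screwLine t) z * φ t = ∫ t : ℝ, sharp (screwLine (-t)) z * φ (-t) :=
    (integral_neg_eq_self (fun t : ℝ ↦ sharp (screwLine t) z * φ t) volume).symm
  have h2 : ∫ t : ℝ, sharp (screwLine (-t)) z * φ (-t) = -∫ t : ℝ, sharp (screwLine t) z * φ t := by
    rw [← integral_neg]
    refine integral_congr_ae (ae_of_all _ fun t ↦ ?_)
    simp only [screwLine_neg, hφ, mul_neg]
  have h3 := h.trans h2
  -- `x = -x` in `ℂ`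
  linear_combination h3 / 2

/-- For an even `ψ`, `Dψ = iψ′` is odd (no differentiability needed: `deriv (ψ ∘ neg) = −(deriv ψ) ∘ neg`).
[cite: Suzuki2025WeilHilbertSpace, eq. (1.8) (TeX l.412–416)] -/
theorem suzukiD_neg_of_even {ψ : ℝ → ℂ} (hψ : ∀ t, ψ (-t) = ψ t) (t : ℝ) :
    suzukiD ψ (-t) = -suzukiD ψ t := by
  have hfun : (fun x ↦ ψ (-x)) = ψ := funext hψ
  have h := deriv_comp_neg (f := ψ) t
  rw [hfun] at h
  -- `h : deriv ψ t = -deriv ψ (-t)`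
  simp only [suzukiD, h, neg_neg, mul_neg]

/-- **`P̂_{Dψ} ≡ 0` for every even `ψ`.** RH-FREE. [cite: Suzuki2025WeilHilbertSpace, (1.7)–(1.8) with l.359] -/
theorem screwPhat_suzukiD_eq_zero_of_even {ψ : ℝ → ℂ} (hψ : ∀ t, ψ (-t) = ψ t) (z : ℂ) :
    screwPhat (suzukiD ψ) z = 0 :=
  screwPhat_eq_zero_of_odd (suzukiD_neg_of_even hψ) z

/-- **`‖ψ‖₀ = 0` for every even `ψ`** ((3.9) as typed). RH-FREE.
[cite: Suzuki2025WeilHilbertSpace, eq. (3.9) (TeX l.1058–1064) with l.359] -/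
theorem screwNormZero_eq_zero_of_even {ψ : ℝ → ℂ} (hψ : ∀ t, ψ (-t) = ψ t) : screwNormZero ψ = 0 := by
  simp only [screwNormZero, screwPhat_suzukiD_eq_zero_of_even hψ, norm_zero, ne_eq,
    OfNat.ofNat_ne_zero, not_false_eq_true, zero_pow, integral_zero, zero_div, Real.sqrt_zero]

/-! ## B. Even test functions with non-vanishing Weil form (unconditional) -/

/-- **An even test function on which the Weil form does not vanish** (unconditionally): by Bombieri's
small-support positivity `Re ⟨g,g⟩_W ≥ ‖g‖₂²` for `tsupport g ⊆ [−a,a]`, `a ≤ a₀` (tree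
`weilQuadratic_coercive`), applied to an even unit vector of the window (`exists_isWeilTest_even_sphere`).
[cite: Bombieri2000, Thm. 12] -/
theorem exists_even_isWeilTest_weilQuadratic_ne_zero :
    ∃ ψ : ℝ → ℂ, IsWeilTest ψ ∧ (∀ t, ψ (-t) = ψ t) ∧ weilQuadratic ψ ≠ 0 := by
  obtain ⟨a₀, ha₀, H⟩ := weilQuadratic_coercive 1
  obtain ⟨g, hg, hsupp, hev, hnorm⟩ := exists_isWeilTest_even_sphere ha₀
  refine ⟨g, hg, hev, fun h0 ↦ ?_⟩
  have h := H a₀ ha₀ le_rfl g hg hsupp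
  rw [hnorm, h0] at h
  norm_num at h

/-! ## C. The five typed records -/

/-- The right-hand side of the typed criterion (1.9) is false unconditionally: at an even `ψ` with
`⟨ψ,ψ⟩_W ≠ 0` it reads `0 = π⟨ψ,ψ⟩_W`. [cite: Suzuki2025WeilHilbertSpace, Thm. 1.4 (TeX l.420–430) with l.359] -/
theorem not_eq19_forall :
    ¬ ∀ ψ : ℝ → ℂ, IsWeilTest ψ →
      ((∫ x : ℝ, ‖screwPhat (suzukiD ψ) x‖ ^ 2 : ℝ) : ℂ) = Real.pi * weilQuadratic ψ := by
  intro h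
  obtain ⟨ψ, hψ, hev, hne⟩ := exists_even_isWeilTest_weilQuadratic_ne_zero
  have e := h ψ hψ
  simp only [screwPhat_suzukiD_eq_zero_of_even hev, norm_zero, ne_eq, OfNat.ofNat_ne_zero,
    not_false_eq_true, zero_pow, integral_zero, Complex.ofReal_zero] at e
  have hπ : (Real.pi : ℂ) ≠ 0 := Complex.ofReal_ne_zero.2 Real.pi_pos.ne'
  exact hne (by simpa [hπ] using e.symm)

/-- The right-hand side of the typed criterion (4.7) (mean-zero test functions) is false unconditionally:
at the odd `φ = Dψ`, `ψ` even with `⟨ψ,ψ⟩_W ≠ 0`, it reads `0 = π⟨Dψ,Dψ⟩_{G_g} = π⟨ψ,ψ⟩_W` by (4.10)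
(`zetaScrewForm_univ_suzukiD`). [cite: Suzuki2025WeilHilbertSpace, Thm. 4.4 (TeX l.1274–1284), (4.10) (l.1312–1324), with l.359] -/
theorem not_eq47_forall_meanZero :
    ¬ ∀ φ : ℝ → ℂ, IsWeilTest φ → ∫ t : ℝ, φ t = 0 →
      ((∫ x : ℝ, ‖screwPhat φ x‖ ^ 2 : ℝ) : ℂ) = Real.pi * zetaScrewForm univ φ φ := by
  intro h
  obtain ⟨ψ, hψ, hev, hne⟩ := exists_even_isWeilTest_weilQuadratic_ne_zero
  have hodd : ∀ t, suzukiD ψ (-t) = -suzukiD ψ t := suzukiD_neg_of_even hev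
  have hmean : ∫ t : ℝ, suzukiD ψ t = 0 := by
    have h1 : ∫ t : ℝ, suzukiD ψ t = ∫ t : ℝ, suzukiD ψ (-t) :=
      (integral_neg_eq_self (fun t : ℝ ↦ suzukiD ψ t) volume).symm
    have h2 : ∫ t : ℝ, suzukiD ψ (-t) = -∫ t : ℝ, suzukiD ψ t := by
      rw [← integral_neg]
      exact integral_congr_ae (ae_of_all _ fun t ↦ hodd t)
    linear_combination (h1.trans h2) / 2
  have e := h (suzukiD ψ) hψ.suzukiD hmean
  rw [zetaScrewForm_univ_suzukiD hψ] at e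
  simp only [screwPhat_eq_zero_of_odd hodd, norm_zero, ne_eq, OfNat.ofNat_ne_zero,
    not_false_eq_true, zero_pow, integral_zero, Complex.ofReal_zero] at e
  have hπ : (Real.pi : ℂ) ≠ 0 := Complex.ofReal_ne_zero.2 Real.pi_pos.ne'
  exact hne (by simpa [hπ] using e.symm)

/-- The right-hand side of the typed criterion (1.10) on `V°(0)` is false unconditionally: the element
`0 ∈ V°(0)` is generated by every even test function `ψ₀` (`𝖥0 = 0 = P̂_{Dψ₀}`), so (1.10) would give
`0 = ⟨ψ₀,ψ₀⟩_W`. [cite: Suzuki2025WeilHilbertSpace, Cor. 1.5 (TeX l.438–451) with l.359] -/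
theorem not_eq110_forall :
    ¬ ∀ ψ ∈ suzukiVcirc, ∀ ψ₀ : ℝ → ℂ, IsWeilTest ψ₀ → IsVcircRep ψ₀ ψ →
      ((2 * ‖ψ‖ ^ 2 : ℝ) : ℂ) = weilQuadratic ψ₀ := by
  intro h
  obtain ⟨ψ₀, hψ₀, hev, hne⟩ := exists_even_isWeilTest_weilQuadratic_ne_zero
  have hrep : IsVcircRep ψ₀ (0 : Lp ℂ 2 (volume : Measure ℝ)) := by
    unfold IsVcircRep
    rw [FourierTransform.fourier_zero]
    filter_upwards [Lp.coeFn_zero ℂ 2 (volume : Measure ℝ)] with ξ hξ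
    rw [hξ, screwPhat_suzukiD_eq_zero_of_even hev, Pi.zero_apply]
  have hmem : (0 : Lp ℂ 2 (volume : Measure ℝ)) ∈ suzukiVcirc := ⟨ψ₀, hψ₀, hrep⟩
  have e := h 0 hmem ψ₀ hψ₀ hrep
  simp at e
  exact hne e.symm

/-- The typed clause (4.4) "for `t, u ∈ ℝ`" is false unconditionally: since `𝔖_{−t} = 𝔖_t` as typed,
the instances `(t,t)` and `(t,−t)` give `G_g(t,t) = G_g(t,−t)`, i.e. `Ψ(2t) = 0`, against `Ψ > 0` on
`(0, log 2]`. [cite: Suzuki2025WeilHilbertSpace, Thm. 4.2 (TeX l.1182–1194) with l.359; Suzuki2023, Thm. 4.1] -/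
theorem not_eq44_forall :
    ¬ ∀ t u : ℝ, (1 / Real.pi : ℂ) * ∫ x : ℝ, screwLine t x * conj (screwLine u x) =
        (zetaScrewKernel t u : ℂ) := by
  intro h
  set t : ℝ := Real.log 2 / 4 with ht
  have e1 := h t t
  have e2 := h t (-t)
  simp only [screwLine_neg] at e2
  have e : (zetaScrewKernel t t : ℂ) = zetaScrewKernel t (-t) := e1.symm.trans e2
  have e' : zetaScrewKernel t t = zetaScrewKernel t (-t) := by exact_mod_cast e
  simp only [zetaScrewKernel, zetaScrew_neg, sub_neg_eq_add, sub_self, zetaScrew_zero] at e'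
  have hlog : 0 < Real.log 2 := Real.log_pos one_lt_two
  have hpos : 0 < zetaScrew (t + t) :=
    Suzuki2023Thm41.zetaScrew_pos_of_le_log_two (by rw [ht]; linarith) (by rw [ht]; linarith)
  linarith

end ScrewLineEvenExtension

open ScrewLineEvenExtension

/-- **`Suzuki2025_lemma32` is false as typed (and as printed under the convention of CJM l.359):**
clause (iii) `‖ψ‖₀ = 0 ⇒ ψ = 0` fails at every even test function `ψ ≠ 0`, since `P̂_{Dψ} ≡ 0` for even
`ψ`. RH-FREE NEGATIVE of record; the intended lemma (zero-expansion convention for `t < 0`) is not this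
statement. [cite: Suzuki2025WeilHilbertSpace, Lemma 3.2 (TeX l.1073–1093) with l.359] -/
theorem Suzuki2025_lemma32_false : ¬ Suzuki2025_lemma32 := by
  rintro ⟨-, -, h3⟩
  obtain ⟨ψ, hψ, hev, hne⟩ := exists_even_isWeilTest_weilQuadratic_ne_zero
  have h0 : ψ = 0 := h3 ψ hψ (screwNormZero_eq_zero_of_even hev)
  apply hne
  rw [h0]
  -- `⟨0,0⟩_W = 0`
  have : weilQuadratic (0 : ℝ → ℂ) = 0 := by
    have hz : IsWeilTest (0 : ℝ → ℂ) := ⟨contDiff_const, HasCompactSupport.zero⟩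
    have h := zetaScrewForm_univ_suzukiD hz
    rw [← h]
    have hD : suzukiD (0 : ℝ → ℂ) = 0 := by funext t; simp [suzukiD]
    simp [zetaScrewForm, hD]
  exact this

/-- **`Suzuki2025_thm42` (typed "RH ⟹ (4.4) for all real `t,u` ∧ screw line") is equivalent to `¬RH`:**
its conclusion is false unconditionally (`not_eq44_forall`). The printed Thm. 4.2 with the zero-expansion
convention for `t < 0` is not this statement. RH-FREE NEGATIVE of record.
[cite: Suzuki2025WeilHilbertSpace, Thm. 4.2 (TeX l.1182–1194) with l.359] -/
theorem Suzuki2025_thm42_iff_not_riemannHypothesis : Suzuki2025_thm42 ↔ ¬ RiemannHypothesis :=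
  ⟨fun h hRH ↦ not_eq44_forall (h hRH).1, fun hn hRH ↦ absurd hRH hn⟩

/-- **`Suzuki2025_thm44` (typed (4.7) criterion ∧ "RH ⟹ (4.8)") is equivalent to `¬RH`:** the right-hand
side of (4.7) is false unconditionally (`not_eq47_forall_meanZero`), so clause (i) `RH ↔ …` is `¬RH` and
clause (ii) `RH → …` (which implies the same right-hand side) is `¬RH` as well. RH-FREE NEGATIVE of record.
[cite: Suzuki2025WeilHilbertSpace, Thm. 4.4 (TeX l.1274–1284) with l.359] -/
theorem Suzuki2025_thm44_iff_not_riemannHypothesis : Suzuki2025_thm44 ↔ ¬ RiemannHypothesis := by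
  refine ⟨fun h hRH ↦ not_eq47_forall_meanZero fun φ hφ _ ↦ h.2 hRH φ hφ, fun hn ↦ ⟨?_, ?_⟩⟩
  · exact ⟨fun hRH ↦ absurd hRH hn, fun hX ↦ (not_eq47_forall_meanZero hX).elim⟩
  · exact fun hRH ↦ absurd hRH hn

/-- **`Suzuki2025_thm14` (typed criterion (1.9), "RH ↔ ‖P̂_{Dψ}‖² = π⟨ψ,ψ⟩_W ∀ψ ∈ C_c^∞(ℝ)") is equivalent
to `¬RH`:** the right-hand side is false unconditionally (`not_eq19_forall`: even `ψ` give `P̂_{Dψ} = 0` but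
`⟨ψ,ψ⟩_W ≠ 0`). RH-FREE NEGATIVE of record. [cite: Suzuki2025WeilHilbertSpace, Thm. 1.4 (TeX l.420–430) with l.359] -/
theorem Suzuki2025_thm14_iff_not_riemannHypothesis : Suzuki2025_thm14 ↔ ¬ RiemannHypothesis :=
  ⟨fun h hRH ↦ not_eq19_forall (h.1 hRH),
    fun hn ↦ ⟨fun hRH ↦ absurd hRH hn, fun hX ↦ (not_eq19_forall hX).elim⟩⟩

/-- **`Suzuki2025_cor15` (typed criterion (1.10) on `V°(0)`) is equivalent to `¬RH`:** the right-hand side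
is false unconditionally (`not_eq110_forall`: `0 ∈ V°(0)` is generated by an even `ψ₀` with `⟨ψ₀,ψ₀⟩_W ≠ 0`).
RH-FREE NEGATIVE of record. [cite: Suzuki2025WeilHilbertSpace, Cor. 1.5 (TeX l.438–451) with l.359] -/
theorem Suzuki2025_cor15_iff_not_riemannHypothesis : Suzuki2025_cor15 ↔ ¬ RiemannHypothesis :=
  ⟨fun h hRH ↦ not_eq110_forall (h.1 hRH),
    fun hn ↦ ⟨fun hRH ↦ absurd hRH hn, fun hX ↦ (not_eq110_forall hX).elim⟩⟩

end Literature.NumberTheory.LFunctions
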